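import Summits.CriticalPhenomena.PercolationContinuityZ3.Theses.PercLowPointHalfSpace
import Summits.CriticalPhenomena.PercolationContinuityZ3.Theorems.PercLowPointHalfSpaceQuantitativeBGNWallDefs
import Summits.CriticalPhenomena.PercolationContinuityZ3.Theorems.PercLowPointHalfSpaceQuantitativeBGNWallTransfer
import Summits.CriticalPhenomena.PercolationContinuityZ3.Theorems.PercLowPointHalfSpaceQuantitativeBGNWallBootstrap
import Summits.CriticalPhenomena.PercolationContinuityZ3.Theorems.PercLowPointHalfSpaceQuantitativeBGNWallTwoGhost
import Summits.CriticalPhenomena.PercolationContinuityZ3.Theorems.PercLowPointHalfSpaceQuantitativeBGNWallChain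
import Summits.CriticalPhenomena.PercolationContinuityZ3.Theorems.PercLowPointHalfSpaceQuantitativeBGNThinFootSlabVolume
import Summits.CriticalPhenomena.PercolationContinuityZ3.Theorems.PercLowPointHalfSpaceQuantitativeBGNArmVolume
import Summits.CriticalPhenomena.PercolationContinuityZ3.Theorems.PercLowPointHalfSpaceQuantitativeBGNThinFootReshape
import Mathlib.Analysis.SpecialFunctions.Pow.Real
import HarnessLib.Audit

/-!
# Line `longrange-wall-ghost-bootstrap` for the crux `QuantitativeBGN` (stmt-CriticalPhenomena-0913) — lead c5 skeleton

Lead: prover-line-stmt-CriticalPhenomena-0913-c5-0 (2026-08-17), continuing leads c3/c4's registered skeleton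
`Cruxes/QuantitativeBGN/Lines/longrange_wall_ghost_bootstrap.lean` (objects in the reviewed definitions file
`Theorems/PercLowPointHalfSpaceQuantitativeBGNWallDefs.lean`, namespace `…Theorems.WallGhost`; crux event `armH` and readback
`quantitativeBGN_iff` from the landed Negative lane; the composition `QuantitativeBGN ⟸ K2_T ∧ K3` landed by c4 in
`Theorems/PercLowPointHalfSpaceQuantitativeBGNWallChain.lean`).

ONE RESHAPE (lead c5), same composition: the thin part K3 `stub_wallThinFootTall` (thin-footed TALL clusters are polynomially
rare) is cut into
* `stub_thinFootSlabVolume` (LANDED p137452, M): `P_p(|C_H(0) ∩ {x₀ < k}| ≥ t, F ≤ m) ≤ m k / t` for EVERY `p` — the ℤ²-level mass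
  transport `E[N_h(U) · 1{F ≤ m} / F] = P(C_H(h e₀) touches the wall with footprint ≤ m) ≤ 1` (`N_h` = number of points of
  `U = C_H(0)` at height `h`, `F = N_0` its footprint) summed over `h < k`, then Markov;
* `stub_armVolume` (LANDED p137693, S): on lattice configurations, `arm_H(0,r) ⟹ |C_H(0)| ≥ r + 1` (a lattice path to sup-distance
  `r` visits `r + 1` distinct vertices);
* `stub_thinFootHigh` (K3', OPEN, the lead's): thin-footed HIGH clusters are polynomially rare —
  `P_{p_c}(C_H(0) reaches height k, F ≤ ⌊k^δ⌋) ≤ C k^{-a}`;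
and `thinFootTall_of` (kernel-checked below): K3 ⟸ K3' + the two provable stubs, with `k = ⌊r^{1/3}⌋+1`, `m = ⌊r^{δ'}⌋`,
`δ' = min(δ/3, 1/6)`: a thin-footed arm either reaches height `k` (K3') or stays below it, and then its `≥ r+1` vertices lie in
the slab `{x₀ < k}`, an event of probability `≤ m k/(r+1) ≤ 2 r^{-1/2}`. Conversely K3 ⟹ K3' trivially (`{U reaches height k}
⊆ arm_H(0,k)`), so the reshape loses nothing: K3 ⟺ K3' ("without loss of generality the thin-footed arm goes straight up").

Crux (fixed, the route's decl): `∃ a C, 0 < a ∧ ∀ r ≥ 1, P_{p_c(ℤ³)}(arm_H(0,r)) ≤ C r^{-a}`.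

Registered stubs (7 = stubs_max): `stub_wallStable` (K2_T, OPEN), `stub_wallTwoGhost` (K1, LANDED p131703),
`stub_wallBootstrap` (LANDED p128998), `stub_wallTransfer` (LANDED p128072), `stub_thinFootSlabVolume` (LANDED p137452),
`stub_armVolume` (LANDED p137693), `stub_thinFootHigh` (K3', OPEN). `QuantitativeBGN_of` concludes the crux BY NAME from the two
open stubs (the five landed stubs are discharged inside; lean check: exactly 2 sorries = the 2 open stubs).

Disproof used (`Cruxes/QuantitativeBGN/Disproof.lean` v5): `p < p_c`/`p = p_c` enter exactly K2_T (false above `p_c`) and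
K3' (at `p_c`); the slab-volume bound and the arm-volume bound are `p`-blind plumbing (true at every `p`); output exponent
`min(min(a/3,1/2), δ'(1-α)/4)` inside the window `(0, 2]` of `armH_lower_bound`; guards `1 ≤ r`, `1 ≤ k`, `1 ≤ n` kept.
-/

noncomputable section

namespace Summit.CriticalPhenomena.PercolationContinuityZ3.Cruxes.QuantitativeBGN.LongrangeWallGhostBootstrap

open scoped Classical ENNReal
open MeasureTheory Filter
open Literature.Probability.Percolation Literature.Probability.LatticeModels
open Summit.CriticalPhenomena.PercolationContinuityZ3.Theorems
open Summit.CriticalPhenomena.PercolationContinuityZ3.Theorems.WallGhost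
open Summit.CriticalPhenomena.PercolationContinuityZ3.Theorems.QuantitativeBGN.Negative
  (armH QuantitativeBGNAt quantitativeBGN_iff)

/-! ## Named statements of the line (local abbreviations; the registered stubs below spell them out) -/

/-- K1 — **basic two-ghost inequality on the wall** (as in c4's skeleton). -/
def WallTwoGhostIneq (α lam : ℝ) : Prop :=
  ∃ C : ℝ, ∀ p : unitInterval, ∀ n : ℕ, 1 ≤ n → ∀ s : Finset WallIdx,
    ∑ x ∈ s, wallBondProb p lam α x.1 / (1 - wallBondProb p lam α x.1) *
        (augWall p lam α).real (wallTwoArm x.1 n) ^ 2 ≤ C * (n : ℝ)⁻¹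

/-- K2_T — **the augmented wall is subcritical below `p_c`** at the pair `(α, λ)`. -/
def AugSubcritical (α lam : ℝ) : Prop :=
  ∀ p : unitInterval, (p : ℝ) < criticalProb (zdGraph 3) (0 : Site 3) →
    ∫⁻ ω, ((clusterH ω 0).encard : ℝ≥0∞) ∂(augWall p lam α) < ⊤

/-- Output of the bootstrap: ONE constant `B` bounding the augmented footprint tail at every `p < p_c`. -/
def UniformFootprintTail (α lam θ B : ℝ) : Prop :=
  ∀ p : unitInterval, (p : ℝ) < criticalProb (zdGraph 3) (0 : Site 3) →
    ∀ n : ℕ, 1 ≤ n → (augWall p lam α).real (footGe 0 n) ≤ B * (n : ℝ) ^ (-θ)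

/-- `FootprintTail(θ)` for the ORIGINAL model AT `p_c`: `P_{p_c}(|C_H(0) ∩ ∂H| ≥ n) ≤ B n^{-θ}`. -/
def FootprintTailCrit (θ B : ℝ) : Prop :=
  ∀ n : ℕ, 1 ≤ n → (bondPercolation (zdGraph 3) (criticalProbI 3)).real (footGe 0 n) ≤ B * (n : ℝ) ^ (-θ)

/-- K3 — **thin-footed tall clusters are polynomially rare** at `p_c(ℤ³)` (no longer a stub: derived below). -/
def ThinFootTall : Prop :=
  ∃ a δ C : ℝ, 0 < a ∧ 0 < δ ∧ ∀ r : ℕ, 1 ≤ r →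
    (bondPercolation (zdGraph 3) (criticalProbI 3)).real
        (armH r ∩ {ω | footAt ω 0 ≤ ((⌊(r : ℝ) ^ δ⌋₊ : ℕ) : ℕ∞)}) ≤ C * (r : ℝ) ^ (-a)

/-- NEW (c5) — **thin-footed clusters are sparse in every slab**: `P_p(|C_H(0) ∩ {x₀ < k}| ≥ t, F ≤ m) ≤ m k / t` for every
bulk density `p` (ℤ²-level mass transport + Markov). -/
def ThinFootSlabVolume : Prop :=
  ∀ p : unitInterval, ∀ k m t : ℕ, 1 ≤ t →
    (bondPercolation (zdGraph 3) p).real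
        ({ω | (t : ℕ∞) ≤ (clusterH ω 0 ∩ {v : Site 3 | v 0 < (k : ℤ)}).encard} ∩
          {ω | footAt ω 0 ≤ (m : ℕ∞)}) ≤ (m : ℝ) * k / t

/-- NEW (c5) — **an arm to sup-distance `r` has at least `r + 1` vertices** (lattice configurations). -/
def ArmVolume : Prop :=
  ∀ ω : BondConfig (Site 3), ω ⊆ (zdGraph 3).edgeSet → ∀ r : ℕ, ω ∈ armH r →
    ((r + 1 : ℕ) : ℕ∞) ≤ (clusterH ω 0).encard

/-- NEW (c5) — K3' **thin-footed HIGH clusters are polynomially rare** at `p_c(ℤ³)` (OPEN, the lead's): the half-space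
cluster of `0` reaches height `k` while touching the wall in at most `⌊k^δ⌋` points. -/
def ThinFootHigh : Prop :=
  ∃ a δ C : ℝ, 0 < a ∧ 0 < δ ∧ ∀ k : ℕ, 1 ≤ k →
    (bondPercolation (zdGraph 3) (criticalProbI 3)).real
        ({ω | ∃ v ∈ clusterH ω 0, (k : ℤ) ≤ v 0} ∩
          {ω | footAt ω 0 ≤ ((⌊(k : ℝ) ^ δ⌋₊ : ℕ) : ℕ∞)}) ≤ C * (k : ℝ) ^ (-a)

/-! ## Registered stubs (signatures spelled out over the WallDefs / Negative vocabulary) -/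

/-- **stub_wallStable (K2_T, OPEN; size L; the lead's second).** For some `α ∈ (0,1)` and some `λ > 0`, the augmented model
(bulk `p` + long-range wall bonds `1 - exp(-λ‖u-v‖^{-(2+α)})`) has finite mean `H`-cluster size at every `p < p_c(ℤ³)`.
Census (c3/c4/c5): provable at each FIXED `p < p_c` (tree-graph bound) but ONE `λ` for all `p < p_c` is special-point
positivity of the weakly long-range-enhanced wall, morally the boundary exponent inequality `x_s > 1 - α/2 (≥ 1/2)` — stronger
information than the crux itself (`x_s > 0` in rate form); no tool in tree or print. -/
theorem stub_wallStable : ∃ α lam : ℝ, 0 < α ∧ α < 1 ∧ 0 < lam ∧ ∀ p : unitInterval, (p : ℝ) < criticalProb (zdGraph 3) (0 : Site 3) → ∫⁻ ω, ((clusterH ω 0).encard : ℝ≥0∞) ∂(augWall p lam α) < ⊤ := by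
  sorry

/-- **stub_wallTwoGhost (K1, LANDED p131703).** The basic quadratic two-ghost inequality on the wall. -/
theorem stub_wallTwoGhost : ∀ α lam : ℝ, 0 < α → 0 < lam → ∃ C : ℝ, ∀ p : unitInterval, ∀ n : ℕ, 1 ≤ n → ∀ s : Finset WallIdx, ∑ x ∈ s, wallBondProb p lam α x.1 / (1 - wallBondProb p lam α x.1) * (augWall p lam α).real (wallTwoArm x.1 n) ^ 2 ≤ C * (n : ℝ)⁻¹ :=
  Summit.CriticalPhenomena.PercolationContinuityZ3.Theorems.stub_wallTwoGhost

/-- **stub_wallBootstrap (LANDED p128998).** Hutchcroft's bootstrap on the wall, exponent `(1-α)/4`. -/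
theorem stub_wallBootstrap : ∀ α lam : ℝ, 0 < α → α < 1 → 0 < lam → (∃ C : ℝ, ∀ p : unitInterval, ∀ n : ℕ, 1 ≤ n → ∀ s : Finset WallIdx, ∑ x ∈ s, wallBondProb p lam α x.1 / (1 - wallBondProb p lam α x.1) * (augWall p lam α).real (wallTwoArm x.1 n) ^ 2 ≤ C * (n : ℝ)⁻¹) → (∀ p : unitInterval, (p : ℝ) < criticalProb (zdGraph 3) (0 : Site 3) → ∫⁻ ω, ((clusterH ω 0).encard : ℝ≥0∞) ∂(augWall p lam α) < ⊤) → ∃ B : ℝ, ∀ p : unitInterval, (p : ℝ) < criticalProb (zdGraph 3) (0 : Site 3) → ∀ n : ℕ, 1 ≤ n → (augWall p lam α).real (footGe 0 n) ≤ B * (n : ℝ) ^ (-((1 - α) / 4)) :=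
  Summit.CriticalPhenomena.PercolationContinuityZ3.Theorems.stub_wallBootstrap

/-- **stub_wallTransfer (LANDED p128072).** Monotone coupling in `λ` and left-continuity at `p_c`. -/
theorem stub_wallTransfer : ∀ α lam θ B : ℝ, 0 ≤ lam → (∀ p : unitInterval, (p : ℝ) < criticalProb (zdGraph 3) (0 : Site 3) → ∀ n : ℕ, 1 ≤ n → (augWall p lam α).real (footGe 0 n) ≤ B * (n : ℝ) ^ (-θ)) → ∀ n : ℕ, 1 ≤ n → (bondPercolation (zdGraph 3) (criticalProbI 3)).real (footGe 0 n) ≤ B * (n : ℝ) ^ (-θ) :=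
  Summit.CriticalPhenomena.PercolationContinuityZ3.Theorems.stub_wallTransfer

/-- **stub_thinFootSlabVolume (NEW, LANDED p137452 `Theorems/PercLowPointHalfSpaceQuantitativeBGNThinFootSlabVolume.lean`, size M).** For every bulk density `p` and all `k m t` with `t ≥ 1`:
`P_p(|C_H(0) ∩ {x₀ < k}| ≥ t ∧ F ≤ m) ≤ m k / t`. Proof: for each height `h`, the transport
`f(u,v) = 1{v + h e₀ ∈ C_H(u)} 1{F_u ≤ m}/F_u` between wall vertices is diagonally invariant under wall shifts, so
(`WallTwoGhost.wall_mtp` + `lintegral_tsum` + `LowPoint.lintegral_shift`) `E[N_h(U) 1{F ≤ m}/F] = E[in-mass at 0] =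
P(1 ≤ F(C_H(h e₀)) ≤ m) ≤ 1`; multiply by `F ≤ m`, sum over `h < k` (the slab count is the sum of the level counts), Markov. -/
theorem stub_thinFootSlabVolume : ∀ p : unitInterval, ∀ k m t : ℕ, 1 ≤ t → (bondPercolation (zdGraph 3) p).real ({ω | (t : ℕ∞) ≤ (clusterH ω 0 ∩ {v : Site 3 | v 0 < (k : ℤ)}).encard} ∩ {ω | footAt ω 0 ≤ (m : ℕ∞)}) ≤ (m : ℝ) * k / t :=
  Summit.CriticalPhenomena.PercolationContinuityZ3.Theorems.stub_thinFootSlabVolume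

/-- **stub_armVolume (NEW, LANDED p137693 `Theorems/PercLowPointHalfSpaceQuantitativeBGNArmVolume.lean`, size S).** On a lattice configuration (`ω ⊆ E(ℤ³)`), if `C_H(0)` reaches sup-distance
`r` then it has at least `r + 1` vertices: an open lattice path from `0` to `y` with `|y i| ≥ r` changes the `i`-th coordinate
by at most one per step, so it visits vertices with `i`-th coordinate `0, ±1, …, ±r` (discrete IVT along the walk, cf.
`LowPoint.exists_level_of_walk`), all in `C_H(0)`. -/
theorem stub_armVolume : ∀ ω : BondConfig (Site 3), ω ⊆ (zdGraph 3).edgeSet → ∀ r : ℕ, ω ∈ armH r → ((r + 1 : ℕ) : ℕ∞) ≤ (clusterH ω 0).encard :=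
  Summit.CriticalPhenomena.PercolationContinuityZ3.Theorems.stub_armVolume

/-- **stub_thinFootHigh (K3', NEW, OPEN; size L; the lead's).** Thin-footed HIGH critical half-space clusters are
polynomially rare: `P_{p_c}(∃ v ∈ C_H(0), v₀ ≥ k, and F ≤ ⌊k^δ⌋) ≤ C k^{-a}` for some `a, δ > 0`. Equivalent to K3 (this
file: `thinFootTall_of`; converse `{∃ v ∈ U, v₀ ≥ k} ⊆ arm_H(0,k)`), implied by the crux, numerically `a(δ=1/2) ≈ 2`; the
honest open content of the thin part ("wlog the thin-footed arm goes straight up"). -/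
theorem stub_thinFootHigh : ∃ a δ C : ℝ, 0 < a ∧ 0 < δ ∧ ∀ k : ℕ, 1 ≤ k → (bondPercolation (zdGraph 3) (criticalProbI 3)).real ({ω | ∃ v ∈ clusterH ω 0, (k : ℤ) ≤ v 0} ∩ {ω | footAt ω 0 ≤ ((⌊(k : ℝ) ^ δ⌋₊ : ℕ) : ℕ∞)}) ≤ C * (k : ℝ) ^ (-a) := by
  sorry

/-! ### Consistency: each named statement IS its registered stub (definitionally) -/

/-- Statement of `stub_wallStable` (K2_T). -/
def WallStableStmt : Prop := ∃ α lam : ℝ, 0 < α ∧ α < 1 ∧ 0 < lam ∧ AugSubcritical α lam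

/-- Statement of `stub_wallTwoGhost` (K1). -/
def WallTwoGhostStmt : Prop := ∀ α lam : ℝ, 0 < α → 0 < lam → WallTwoGhostIneq α lam

/-- Statement of `stub_wallBootstrap`. -/
def WallBootstrapStmt : Prop :=
  ∀ α lam : ℝ, 0 < α → α < 1 → 0 < lam → WallTwoGhostIneq α lam → AugSubcritical α lam →
    ∃ B : ℝ, UniformFootprintTail α lam ((1 - α) / 4) B

/-- Statement of `stub_wallTransfer`. -/
def WallTransferStmt : Prop :=
  ∀ α lam θ B : ℝ, 0 ≤ lam → UniformFootprintTail α lam θ B → FootprintTailCrit θ B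

theorem wallStable_holds : WallStableStmt := stub_wallStable
theorem wallTwoGhost_holds : WallTwoGhostStmt := stub_wallTwoGhost
theorem wallBootstrap_holds : WallBootstrapStmt := stub_wallBootstrap
theorem wallTransfer_holds : WallTransferStmt := stub_wallTransfer
theorem thinFootSlabVolume_holds : ThinFootSlabVolume := stub_thinFootSlabVolume
theorem armVolume_holds : ArmVolume := stub_armVolume
theorem thinFootHigh_holds : ThinFootHigh := stub_thinFootHigh

namespace Registered

/-- Alias of `WallStableStmt` keyed by the registered stub name. -/
abbrev stub_wallStable : Prop := WallStableStmt
/-- Alias of `WallTwoGhostStmt` keyed by the registered stub name. -/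
abbrev stub_wallTwoGhost : Prop := WallTwoGhostStmt
/-- Alias of `WallBootstrapStmt` keyed by the registered stub name. -/
abbrev stub_wallBootstrap : Prop := WallBootstrapStmt
/-- Alias of `WallTransferStmt` keyed by the registered stub name. -/
abbrev stub_wallTransfer : Prop := WallTransferStmt
/-- Alias of `ThinFootSlabVolume` keyed by the registered stub name. -/
abbrev stub_thinFootSlabVolume : Prop := ThinFootSlabVolume
/-- Alias of `ArmVolume` keyed by the registered stub name. -/
abbrev stub_armVolume : Prop := ArmVolume
/-- Alias of `ThinFootHigh` keyed by the registered stub name. -/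
abbrev stub_thinFootHigh : Prop := ThinFootHigh

end Registered

/-! ## The composition (kernel-checked, no `sorry` outside the stubs) -/

/-- Arithmetic of the scales: for `r ≥ 1`, `k = ⌊r^{1/3}⌋ + 1` satisfies `r^{1/3} ≤ k ≤ 2 r^{1/3}`. [folklore] -/
theorem scale_k_bounds {r : ℕ} (hr : 1 ≤ r) :
    (r : ℝ) ^ ((1 : ℝ) / 3) ≤ ((⌊(r : ℝ) ^ ((1 : ℝ) / 3)⌋₊ + 1 : ℕ) : ℝ) ∧
      ((⌊(r : ℝ) ^ ((1 : ℝ) / 3)⌋₊ + 1 : ℕ) : ℝ) ≤ 2 * (r : ℝ) ^ ((1 : ℝ) / 3) := by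
  have hr1 : (1 : ℝ) ≤ r := by exact_mod_cast hr
  have hx1 : (1 : ℝ) ≤ (r : ℝ) ^ ((1 : ℝ) / 3) := Real.one_le_rpow hr1 (by norm_num)
  constructor
  · push_cast
    exact (Nat.lt_floor_add_one _).le
  · push_cast
    have := Nat.floor_le (a := (r : ℝ) ^ ((1 : ℝ) / 3)) (by positivity)
    linarith

/-- **K3 ⟸ K3' + slab volume + arm volume** (the reshape of the thin part). With `a, δ` from K3', put
`δ' = min(δ/3, 1/6)`, `k = ⌊r^{1/3}⌋ + 1`, `m = ⌊r^{δ'}⌋ ≤ ⌊k^δ⌋`. On lattice configurations (a.s.), a thin-footed arm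
`arm_H(0,r) ∩ {F ≤ m}` either has a vertex at height `≥ k` — an event of probability `≤ C k^{-a} ≤ C⁺ r^{-a/3}` by K3' — or
lies in the slab `{x₀ < k}`, where its `≥ r + 1` vertices (`stub_armVolume`) make up an event of probability
`≤ m k/(r+1) ≤ 2 r^{-1/2}` (`stub_thinFootSlabVolume`). Output: exponent `min(a/3, 1/2)`, thinness `δ'`. -/
theorem thinFootTall_of (hV : ThinFootSlabVolume) (hA : ArmVolume) (hH : ThinFootHigh) : ThinFootTall := by
  obtain ⟨a, δ, C, ha, hδ, hH⟩ := hH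
  set δ' : ℝ := min (δ / 3) (1 / 6) with hδ'
  have hδ'pos : 0 < δ' := lt_min (by linarith) (by norm_num)
  refine ⟨min (a / 3) (1 / 2), δ', max C 0 + 2, lt_min (by linarith) (by norm_num), hδ'pos, fun r hr => ?_⟩
  set μ := bondPercolation (zdGraph 3) (criticalProbI 3) with hμ
  have hr0 : (0 : ℝ) < r := by exact_mod_cast hr
  have hr1 : (1 : ℝ) ≤ r := by exact_mod_cast hr
  -- the two scales
  set k : ℕ := ⌊(r : ℝ) ^ ((1 : ℝ) / 3)⌋₊ + 1 with hk
  set m : ℕ := ⌊(r : ℝ) ^ δ'⌋₊ with hm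
  obtain ⟨hk_ge, hk_le⟩ := scale_k_bounds hr
  have hk1 : 1 ≤ k := Nat.succ_le_succ (Nat.zero_le _)
  have hx0 : (0 : ℝ) < (r : ℝ) ^ ((1 : ℝ) / 3) := Real.rpow_pos_of_pos hr0 _
  have hk0 : (0 : ℝ) < k := hx0.trans_le hk_ge
  -- `m ≤ ⌊k^δ⌋`
  have hmk : m ≤ ⌊(k : ℝ) ^ δ⌋₊ := by
    apply Nat.floor_mono
    calc (r : ℝ) ^ δ' ≤ (r : ℝ) ^ (δ / 3) := Real.rpow_le_rpow_of_exponent_le hr1 (min_le_left _ _)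
      _ = ((r : ℝ) ^ ((1 : ℝ) / 3)) ^ δ := by rw [← Real.rpow_mul hr0.le]; ring_nf
      _ ≤ (k : ℝ) ^ δ := Real.rpow_le_rpow hx0.le hk_ge hδ.le
  -- the events
  set A : Set (BondConfig (Site 3)) := armH r ∩ {ω | footAt ω 0 ≤ ((⌊(r : ℝ) ^ δ'⌋₊ : ℕ) : ℕ∞)} with hAdef
  set B₁ : Set (BondConfig (Site 3)) :=
    {ω | ∃ v ∈ clusterH ω 0, (k : ℤ) ≤ v 0} ∩ {ω | footAt ω 0 ≤ ((⌊(k : ℝ) ^ δ⌋₊ : ℕ) : ℕ∞)} with hB₁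
  set B₂ : Set (BondConfig (Site 3)) :=
    {ω | (((r + 1 : ℕ) : ℕ∞)) ≤ (clusterH ω 0 ∩ {v : Site 3 | v 0 < (k : ℤ)}).encard} ∩
      {ω | footAt ω 0 ≤ (m : ℕ∞)} with hB₂
  set E : Set (BondConfig (Site 3)) := {ω | ω ⊆ (zdGraph 3).edgeSet} with hE
  -- a.s. only lattice edges are open
  have hEc : μ Eᶜ = 0 := by
    have hae : ∀ᵐ ω ∂μ, ω ⊆ (zdGraph 3).edgeSet := ProbabilityTheory.setBernoulli_ae_subset
    rw [ae_iff] at hae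
    simpa [hE, Set.compl_setOf] using hae
  -- the split
  have hsplit : A ⊆ B₁ ∪ B₂ ∪ Eᶜ := by
    intro ω hω
    by_cases hωE : ω ∈ E
    · obtain ⟨harm, hfoot⟩ := hω
      by_cases hhigh : ∃ v ∈ clusterH ω 0, (k : ℤ) ≤ v 0
      · refine Or.inl (Or.inl ⟨hhigh, ?_⟩)
        exact le_trans (show footAt ω 0 ≤ (m : ℕ∞) from hfoot) (by exact_mod_cast hmk)
      · refine Or.inl (Or.inr ⟨?_, hfoot⟩)
        push Not at hhigh
        have hsub : clusterH ω 0 ∩ {v : Site 3 | v 0 < (k : ℤ)} = clusterH ω 0 := by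
          ext v
          simp only [Set.mem_inter_iff, Set.mem_setOf_eq, and_iff_left_iff_imp]
          exact fun hv => hhigh v hv
        rw [Set.mem_setOf_eq, hsub]
        exact hA ω hωE r harm
    · exact Or.inr hωE
  -- the two probability bounds
  have hB₁le : μ.real B₁ ≤ C * (k : ℝ) ^ (-a) := hH k hk1
  have hB₂le : μ.real B₂ ≤ (m : ℝ) * k / ((r + 1 : ℕ) : ℝ) :=
    hV (criticalProbI 3) k m (r + 1) (Nat.succ_le_succ (Nat.zero_le _))
  have hEreal : μ.real Eᶜ = 0 := by simp [Measure.real, hEc]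
  have hAle : μ.real A ≤ μ.real B₁ + μ.real B₂ := by
    calc μ.real A ≤ μ.real (B₁ ∪ B₂ ∪ Eᶜ) := measureReal_mono hsplit
      _ ≤ μ.real (B₁ ∪ B₂) + μ.real Eᶜ := measureReal_union_le _ _
      _ ≤ μ.real B₁ + μ.real B₂ + μ.real Eᶜ := add_le_add (measureReal_union_le _ _) le_rfl
      _ = μ.real B₁ + μ.real B₂ := by rw [hEreal, add_zero]
  -- arithmetic: first term
  have hmin₁ : (r : ℝ) ^ (-(a / 3)) ≤ (r : ℝ) ^ (-(min (a / 3) (1 / 2))) :=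
    Real.rpow_le_rpow_of_exponent_le hr1 (neg_le_neg (min_le_left _ _))
  have hmin₂ : (r : ℝ) ^ (-(1 / 2 : ℝ)) ≤ (r : ℝ) ^ (-(min (a / 3) (1 / 2))) :=
    Real.rpow_le_rpow_of_exponent_le hr1 (neg_le_neg (min_le_right _ _))
  have hka : (k : ℝ) ^ (-a) ≤ (r : ℝ) ^ (-(a / 3)) := by
    calc (k : ℝ) ^ (-a) ≤ ((r : ℝ) ^ ((1 : ℝ) / 3)) ^ (-a) :=
          Real.rpow_le_rpow_of_nonpos hx0 hk_ge (by linarith)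
      _ = (r : ℝ) ^ (-(a / 3)) := by rw [← Real.rpow_mul hr0.le]; ring_nf
  have h1 : C * (k : ℝ) ^ (-a) ≤ max C 0 * (r : ℝ) ^ (-(min (a / 3) (1 / 2))) :=
    calc C * (k : ℝ) ^ (-a) ≤ max C 0 * (k : ℝ) ^ (-a) :=
          mul_le_mul_of_nonneg_right (le_max_left _ _) (Real.rpow_nonneg hk0.le _)
      _ ≤ max C 0 * (r : ℝ) ^ (-(min (a / 3) (1 / 2))) :=
          mul_le_mul_of_nonneg_left (hka.trans hmin₁) (le_max_right _ _)
  -- arithmetic: second term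
  have hm_le : (m : ℝ) ≤ (r : ℝ) ^ ((1 : ℝ) / 6) := by
    calc (m : ℝ) ≤ (r : ℝ) ^ δ' := Nat.floor_le (Real.rpow_nonneg hr0.le _)
      _ ≤ (r : ℝ) ^ ((1 : ℝ) / 6) := Real.rpow_le_rpow_of_exponent_le hr1 (min_le_right _ _)
  have h2 : (m : ℝ) * k / ((r + 1 : ℕ) : ℝ) ≤ 2 * (r : ℝ) ^ (-(min (a / 3) (1 / 2))) := by
    have hr1' : (r : ℝ) ≤ ((r + 1 : ℕ) : ℝ) := by push_cast; linarith
    calc (m : ℝ) * k / ((r + 1 : ℕ) : ℝ)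
        ≤ (r : ℝ) ^ ((1 : ℝ) / 6) * (2 * (r : ℝ) ^ ((1 : ℝ) / 3)) / (r : ℝ) := by
          gcongr
      _ = 2 * ((r : ℝ) ^ ((1 : ℝ) / 6) * (r : ℝ) ^ ((1 : ℝ) / 3) * (r : ℝ) ^ (-(1 : ℝ))) := by
          rw [Real.rpow_neg_one, div_eq_mul_inv]; ring
      _ = 2 * (r : ℝ) ^ (-(1 / 2 : ℝ)) := by
          rw [← Real.rpow_add hr0, ← Real.rpow_add hr0]; norm_num
      _ ≤ 2 * (r : ℝ) ^ (-(min (a / 3) (1 / 2))) := by linarith [hmin₂]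
  -- conclusion
  calc μ.real A ≤ μ.real B₁ + μ.real B₂ := hAle
    _ ≤ C * (k : ℝ) ^ (-a) + (m : ℝ) * k / ((r + 1 : ℕ) : ℝ) := add_le_add hB₁le hB₂le
    _ ≤ max C 0 * (r : ℝ) ^ (-(min (a / 3) (1 / 2))) + 2 * (r : ℝ) ^ (-(min (a / 3) (1 / 2))) :=
        add_le_add h1 h2
    _ = (max C 0 + 2) * (r : ℝ) ^ (-(min (a / 3) (1 / 2))) := by ring

/-- **K3' ⟸ K3** (the reshape loses nothing): a cluster vertex at height `≥ k` is at sup-distance `≥ k`, so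
`{∃ v ∈ C_H(0), v₀ ≥ k} ⊆ arm_H(0,k)`, and the thin-foot thresholds agree. [folklore] -/
theorem thinFootHigh_of_thinFootTall (h : ThinFootTall) : ThinFootHigh := by
  obtain ⟨a, δ, C, ha, hδ, h⟩ := h
  refine ⟨a, δ, C, ha, hδ, fun k hk => le_trans (measureReal_mono ?_) (h k hk)⟩
  rintro ω ⟨⟨v, hv, hvk⟩, hfoot⟩
  refine ⟨⟨v, ⟨0, ?_⟩, hv⟩, hfoot⟩
  exact hvk.trans (le_abs_self _)

/-- **`QuantitativeBGN_of`**: the two OPEN registered stubs (K2_T `stub_wallStable`, K3' `stub_thinFootHigh`) imply the crux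
`Summit.CriticalPhenomena.PercolationContinuityZ3.Theses.PercLowPointHalfSpace.QuantitativeBGN` BY NAME; the five landed stubs
(K1 `stub_wallTwoGhost`, `stub_wallBootstrap`, `stub_wallTransfer`, `stub_thinFootSlabVolume`, `stub_armVolume`) are discharged
inside (kernel-checked; no `sorry` outside the two open stubs). -/
theorem QuantitativeBGN_of
    (h₁ : Registered.stub_wallStable) (hH : Registered.stub_thinFootHigh) :
    Summit.CriticalPhenomena.PercolationContinuityZ3.Theses.PercLowPointHalfSpace.QuantitativeBGN :=
  quantitativeBGN_of_wallStable_of_thinFootTall h₁ (thinFootTall_of thinFootSlabVolume_holds armVolume_holds hH)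

/-- The same composition through the LANDED reshape file (`…ThinFootReshape.lean`, p138124): K2_T + K3' ⟹ crux. -/
theorem QuantitativeBGN_of' (h₁ : Registered.stub_wallStable) (hH : Registered.stub_thinFootHigh) :
    Summit.CriticalPhenomena.PercolationContinuityZ3.Theses.PercLowPointHalfSpace.QuantitativeBGN :=
  quantitativeBGN_of_wallStable_of_thinFootHigh h₁ hH

/-- Wiring check: plugging the (sorried) open stubs into the composition yields the crux. -/
example : Summit.CriticalPhenomena.PercolationContinuityZ3.Theses.PercLowPointHalfSpace.QuantitativeBGN :=
  QuantitativeBGN_of wallStable_holds thinFootHigh_holds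

end Summit.CriticalPhenomena.PercolationContinuityZ3.Cruxes.QuantitativeBGN.LongrangeWallGhostBootstrap

end
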